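import Literature.Computability.Complexity.ACRealizeVec
import HarnessLib

/-!
# Multi-output constant-depth circuits with sharing over an arbitrary basis: `ACVecOver`

`ACRealizeVec.lean` provides `ACVec f d s` — ONE well-formed gate list over `acBasis` with `≤ s`
gates and a family of output wires of `acWeight`-depth `≤ d` carrying a multi-output Boolean map
`f : (ι → Bool) → (κ → Bool)` — together with *composition with sharing* (`ACVec.comp`: depths and
sizes ADD, the inner layer is laid down once). `ACRealizeOver.lean` provides the single-output
calculus `ACRealOver B f d s` over an arbitrary basis `B` (e.g. `tcBasis`, majority gates). This
file is the common generalisation needed to build `TC⁰` circuits layer by layer (threshold layer,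
`AC⁰` logic, threshold layer, … — the shape of the textbook `TC⁰` algorithms for iterated
addition and multiplication, Vollmer 1999, §1.4; Siu–Roychowdhury–Kailath 1993):

* `ACVecOver B f d s` — `ACVec` with `acBasis` replaced by the basis `B`;
* `acVecOver_ofBlocks` (a layer from single-output `ACRealOver` blocks: sizes add, depth is the
  max), `ACVecOver.comp` (composition with sharing: depths and sizes add), `ACVecOver.prod`
  (juxtaposition of two multi-output realizations on the same inputs), `acVecOver_reindex` /
  `ACVecOver.rewire` (renaming inputs is free), `ACVecOver.proj` (one output as an `ACRealOver`),
  `outMap`, `mono`, `congr`, `basis_mono`, and the conversions `ACVec.toOver`, `ACRealOver.toVec`.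

Everything is proved; the relocation lemmas are those of `CircuitComposition.lean`
(`GateList.vals_append_reloc`), `ACRealize.lean` (`GateList.vals_append_par`,
`GateList.wdepths_append_par`) and `ACRealizeOver.lean` (`GateList.wdepths_append_reloc_le`).
Mathlib has no Boolean circuits.

## References

* H. Vollmer, *Introduction to Circuit Complexity* (1999), §1.2 (composition of circuits: depth
  and size add), §1.4 (arithmetic in `TC⁰`).
* S. Arora, B. Barak, *Computational Complexity: A Modern Approach* (2009), Def. 6.1, Rem. 6.4,
  §14.4.2 (`TC⁰`).
-/

namespace Literature.Computability.Complexity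

open Finset GateList

variable {ι ι' κ κ' μ : Type*}

/-- `ACVecOver B f d s`: some well-formed gate list over the basis `B` with at most `s` gates has
output wires `o k` (`k : κ`), each of `acWeight`-depth at most `d` (negations free), carrying
`f x k` on every input `x` — a multi-output circuit of depth `d` and size `s` over `B`
(Vollmer 1999, §1.2). For `B = acBasis` this is `ACVec`; for `κ = Unit` it is `ACRealOver`. [cite: Vollmer1999, §1.2] -/
def ACVecOver (B : Set GateFn) (f : (ι → Bool) → κ → Bool) (d s : ℕ) : Prop :=
  ∃ (gs : List (Gate ι)) (o : κ → ι ⊕ ℕ), WF gs ∧ (∀ g ∈ gs, g.fn ∈ B) ∧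
    (∀ k, OutOK gs.length (o k)) ∧ gs.length ≤ s ∧
      (∀ k, wireDepthOf (wdepths acWeight gs) (o k) ≤ d) ∧ ∀ x k, wireOf x (vals gs x) (o k) = f x k

/-- `ACVec` is `ACVecOver acBasis` (definitional). [folklore] -/
theorem acVecOver_acBasis_iff (f : (ι → Bool) → κ → Bool) (d s : ℕ) :
    ACVecOver acBasis f d s ↔ ACVec f d s := Iff.rfl

/-- A realization over `acBasis` is one over every basis containing it. [folklore] -/
theorem ACVec.toOver {B : Set GateFn} {f : (ι → Bool) → κ → Bool} {d s : ℕ} (h : ACVec f d s)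
    (hB : acBasis ⊆ B) : ACVecOver B f d s := by
  obtain ⟨gs, o, hwf, hb, ho, hl, hdep, hev⟩ := h
  exact ⟨gs, o, hwf, fun g hg => hB (hb g hg), ho, hl, hdep, hev⟩

namespace ACVecOver

variable {B B' : Set GateFn} {f g : (ι → Bool) → κ → Bool} {d d' s s' : ℕ}

/-- Monotonicity in the basis. [folklore] -/
theorem basis_mono (h : ACVecOver B f d s) (hBB' : B ⊆ B') : ACVecOver B' f d s := by
  obtain ⟨gs, o, hwf, hb, ho, hl, hdep, hev⟩ := h
  exact ⟨gs, o, hwf, fun g hg => hBB' (hb g hg), ho, hl, hdep, hev⟩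

/-- Monotonicity in depth and size. [folklore] -/
theorem mono (h : ACVecOver B f d s) (hd : d ≤ d') (hs : s ≤ s') : ACVecOver B f d' s' := by
  obtain ⟨gs, o, hwf, hb, ho, hl, hdep, hev⟩ := h
  exact ⟨gs, o, hwf, hb, ho, hl.trans hs, fun k => (hdep k).trans hd, hev⟩

/-- Extensionality in the computed map. [folklore] -/
theorem congr (h : ACVecOver B f d s) (hfg : ∀ x k, f x k = g x k) : ACVecOver B g d s := by
  obtain ⟨gs, o, hwf, hb, ho, hl, hdep, hev⟩ := h
  exact ⟨gs, o, hwf, hb, ho, hl, hdep, fun x k => (hev x k).trans (hfg x k)⟩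

/-- Selecting / duplicating / reindexing output wires is free. [folklore] -/
theorem outMap (h : ACVecOver B f d s) (r : κ' → κ) : ACVecOver B (fun x k' => f x (r k')) d s := by
  obtain ⟨gs, o, hwf, hb, ho, hl, hdep, hev⟩ := h
  exact ⟨gs, fun k' => o (r k'), hwf, hb, fun k' => ho _, hl, fun k' => hdep _, fun x k' => hev x _⟩

/-- One output of a multi-output realization, as a single-output realization over `B`. [folklore] -/
theorem proj (h : ACVecOver B f d s) (k : κ) : ACRealOver B (fun x => f x k) d s := by
  obtain ⟨gs, o, hwf, hb, ho, hl, hdep, hev⟩ := h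
  exact ⟨gs, o k, hwf, hb, ho k, hl, hdep k, fun x => hev x k⟩

/-- **Extraction of circuits**: every output is computed by a circuit over `B` of `acDepth ≤ d`
and size `≤ s`. [cite: AroraBarakCC2009, Rem. 6.4] -/
theorem toCircuit (h : ACVecOver B f d s) (k : κ) :
    ∃ C : Circuit ι, C.IsOver B ∧ C.acDepth ≤ d ∧ C.size ≤ s ∧ C.Computes fun x => f x k :=
  (h.proj k).toCircuit

end ACVecOver

/-- A single-output realization over `B` is a one-output `ACVecOver B`. [folklore] -/
theorem ACRealOver.toVec {B : Set GateFn} {f : (ι → Bool) → Bool} {d s : ℕ}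
    (h : ACRealOver B f d s) : ACVecOver B (fun x (_ : Unit) => f x) d s := by
  obtain ⟨gs, o, hwf, hb, ho, hl, hdep, hev⟩ := h
  exact ⟨gs, fun _ => o, hwf, hb, fun _ => ho, hl, fun _ => hdep, fun x _ => hev x⟩

/-! ### A layer from single-output blocks -/

/-- **Juxtaposition of blocks over `B`** (Vollmer 1999, §1.2): if each `f j` (`j : Fin M`) is
realized over `B` at depth `d` with `s j` gates then `x ↦ (f j x)ⱼ` is realized over `B` at depth
`d` with `∑ⱼ s j` gates (lay the blocks side by side). [cite: Vollmer1999, §1.2] -/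
theorem acVecOver_ofBlocks {B : Set GateFn} {M : ℕ} {f : Fin M → (ι → Bool) → Bool} {d : ℕ}
    {s : Fin M → ℕ} (h : ∀ j, ACRealOver B (f j) d (s j)) :
    ACVecOver B (fun x j => f j x) d (∑ j, s j) := by
  choose gs o hwf hB ho hl hdep hev using h
  set bs : List (List (Gate ι) × (ι ⊕ ℕ)) := List.ofFn fun j => (gs j, o j) with hbs
  have hbs_len : bs.length = M := by simp [hbs]
  have hmem : ∀ b ∈ bs, ∃ j, b = (gs j, o j) := by
    intro b hb
    simp only [hbs, List.mem_ofFn] at hb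
    obtain ⟨j, rfl⟩ := hb
    exact ⟨j, rfl⟩
  have hO : ∀ b ∈ bs, OutOK b.1.length b.2 := by
    intro b hb; obtain ⟨j, rfl⟩ := hmem b hb; exact ho j
  have houts_len : (parBlocks bs).2.length = M := by rw [length_parBlocks_snd, hbs_len]
  have hbsk : ∀ j : Fin M, bs[j.1]'(by rw [hbs_len]; exact j.2) = (gs j, o j) := by
    intro j; simp [hbs]
  refine ⟨(parBlocks bs).1, fun j => (parBlocks bs).2[j.1]'(by rw [houts_len]; exact j.2),
    wf_parBlocks bs fun b hb => ?_, fn_mem_parBlocks bs fun b hb => ?_, fun j => ?_, ?_,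
    fun j => ?_, fun x j => ?_⟩
  · obtain ⟨j, rfl⟩ := hmem b hb; exact hwf j
  · obtain ⟨j, rfl⟩ := hmem b hb; exact hB j
  · exact outOK_parBlocks bs hO _ (List.getElem_mem _)
  · rw [length_parBlocks_fst]
    simp only [hbs, List.map_ofFn, List.sum_ofFn, Function.comp_def]
    exact Finset.sum_le_sum fun j _ => hl j
  · have := wireDepthOf_parBlocks acWeight bs hO j.1 (by rw [houts_len]; exact j.2)
      (by rw [hbs_len]; exact j.2)
    rw [hbsk j] at this
    rw [this]
    exact hdep j
  · have := wireOf_parBlocks x bs hO j.1 (by rw [houts_len]; exact j.2)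
      (by rw [hbs_len]; exact j.2)
    rw [hbsk j] at this
    rw [this]
    exact hev j x

/-- Juxtaposition of blocks over `B` with a uniform size bound: `M * s` gates. [cite: Vollmer1999, §1.2] -/
theorem acVecOver_ofBlocks_const {B : Set GateFn} {M : ℕ} {f : Fin M → (ι → Bool) → Bool}
    {d s : ℕ} (h : ∀ j, ACRealOver B (f j) d s) : ACVecOver B (fun x j => f j x) d (M * s) :=
  (acVecOver_ofBlocks h).mono le_rfl (by simp)

/-- Juxtaposition of blocks indexed by a finite type (through an enumeration). [cite: Vollmer1999, §1.2] -/
theorem acVecOver_ofBlocks_fintype {B : Set GateFn} [Fintype κ] {f : κ → (ι → Bool) → Bool}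
    {d : ℕ} {s : κ → ℕ} (h : ∀ k, ACRealOver B (f k) d (s k)) :
    ACVecOver B (fun x k => f k x) d (∑ k, s k) := by
  set e := Fintype.equivFin κ
  have h' : ∀ j : Fin (Fintype.card κ), ACRealOver B (f (e.symm j)) d (s (e.symm j)) := fun j => h _
  have hv := acVecOver_ofBlocks h'
  rw [show (∑ j, s (e.symm j)) = ∑ k, s k from Equiv.sum_comp e.symm s] at hv
  exact (hv.outMap e).congr fun x k => by simp

/-- Blocks indexed by a finite type with a uniform size bound: `card κ * s` gates. [cite: Vollmer1999, §1.2] -/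
theorem acVecOver_ofBlocks_fintype_const {B : Set GateFn} [Fintype κ] {f : κ → (ι → Bool) → Bool}
    {d s : ℕ} (h : ∀ k, ACRealOver B (f k) d s) :
    ACVecOver B (fun x k => f k x) d (Fintype.card κ * s) :=
  (acVecOver_ofBlocks_fintype h).mono le_rfl (by simp)

/-! ### Composition with sharing -/

/-- **Composition with sharing over `B`** (Vollmer 1999, §1.2): if `F : {0,1}^κ → {0,1}^μ` is
realized over `B` at depth `d₁` with `s₁` gates and `f : {0,1}^ι → {0,1}^κ` at depth `d` with `s`
gates, then `x ↦ F (f x)` is realized over `B` at depth `d₁ + d` with `s₁ + s` gates: the program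
of `f` is laid down once and the program of `F` relocated behind it, its input `k` re-wired to the
`k`-th output wire of `f`. [cite: Vollmer1999, §1.2] -/
theorem ACVecOver.comp {B : Set GateFn} {F : (κ → Bool) → μ → Bool} {d₁ s₁ : ℕ}
    (hF : ACVecOver B F d₁ s₁) {f : (ι → Bool) → κ → Bool} {d s : ℕ} (hf : ACVecOver B f d s) :
    ACVecOver B (fun x => F (f x)) (d₁ + d) (s₁ + s) := by
  obtain ⟨gsF, oF, hwfF, hBF, hoF, hlF, hdepF, hevF⟩ := hF
  obtain ⟨G, ρ, hwfG, hBG, hρ', hlG, hdepG, hevG⟩ := hf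
  have hρ : WiresOK G.length ρ := fun j m hm => hρ' j m hm
  obtain ⟨ds', hds', hlen', hle'⟩ := wdepths_append_reloc_le acWeight G gsF ρ hρ d hdepG
  refine ⟨G ++ gsF.map (reloc ρ G.length), fun k => shiftWire ρ G.length (oF k),
    hwfG.append_reloc hwfF hρ, ?_, fun k => ?_, ?_, fun k => ?_, fun x k => ?_⟩
  · intro g' hg'
    rw [List.mem_append, List.mem_map] at hg'
    rcases hg' with hg' | ⟨g₀, hg₀, rfl⟩
    · exact hBG g' hg'
    · rw [reloc_fn]; exact hBF g₀ hg₀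
  · rw [List.length_append, List.length_map]
    exact wiresOK_shiftWire hρ (fun k m hm => hoF k m hm) k
  · rw [List.length_append, List.length_map, add_comm]
    exact Nat.add_le_add hlF hlG
  · rw [hds']
    have hρd : WiresOK (wdepths acWeight G).length ρ := by rw [length_wdepths]; exact hρ
    have := wireDepthOf_shiftWire_le (ds := wdepths acWeight G) ρ hρd hdepG hle' (oF k) (hdepF k)
    rw [length_wdepths] at this
    exact this
  · show wireOf x (vals (G ++ gsF.map (reloc ρ G.length)) x) (shiftWire ρ G.length (oF k)) = _
    rw [vals_append_reloc G gsF ρ hρ x,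
      wireOf_shiftWire x (vals G x) _ (length_vals G x) ρ hρ (oF k)]
    have hx : (fun i => wireOf x (vals G x) (ρ i)) = f x := funext (hevG x)
    rw [hx]
    exact hevF _ k

/-- Composition of a single-output outer realization over `B` with a shared inner layer. [cite: Vollmer1999, §1.2] -/
theorem ACRealOver.compVec {B : Set GateFn} {F : (κ → Bool) → Bool} {d₁ s₁ : ℕ}
    (hF : ACRealOver B F d₁ s₁) {f : (ι → Bool) → κ → Bool} {d s : ℕ} (hf : ACVecOver B f d s) :
    ACRealOver B (fun x => F (f x)) (d₁ + d) (s₁ + s) :=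
  (hF.toVec.comp hf).proj ()

/-! ### Renaming input variables; identity layer -/

/-- The re-indexing layer `y ↦ (y (e i))ᵢ` costs nothing over any basis: no gates, depth `0`. [folklore] -/
theorem acVecOver_reindex (B : Set GateFn) (e : ι → ι') :
    ACVecOver B (fun (y : ι' → Bool) i => y (e i)) 0 0 :=
  ⟨[], fun i => Sum.inl (e i), WF.nil, (by simp), (fun _ _ h => by cases h), le_rfl,
    (fun _ => by simp), fun _ _ => rfl⟩

/-- The identity layer (all inputs passed through as outputs) costs nothing. [folklore] -/
theorem acVecOver_id (B : Set GateFn) : ACVecOver B (fun (x : ι → Bool) => x) 0 0 :=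
  acVecOver_reindex B _root_.id

/-- **Renaming the inputs** of a realization along `e : ι → ι'`. [cite: Vollmer1999, §1.2] -/
theorem ACVecOver.rewire {B : Set GateFn} {f : (ι → Bool) → κ → Bool} {d s : ℕ}
    (h : ACVecOver B f d s) (e : ι → ι') :
    ACVecOver B (fun y : ι' → Bool => f (fun i => y (e i))) d s := by
  simpa using h.comp (acVecOver_reindex B e)

/-- Renaming the inputs of a single-output realization over `B`. [cite: Vollmer1999, §1.2] -/
theorem ACRealOver.rewire {B : Set GateFn} {f : (ι → Bool) → Bool} {d s : ℕ}
    (h : ACRealOver B f d s) (e : ι → ι') :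
    ACRealOver B (fun y : ι' → Bool => f (fun i => y (e i))) d s :=
  (h.toVec.rewire e).proj ()

/-! ### Juxtaposition of two multi-output realizations -/

/-- **Juxtaposition** (Vollmer 1999, §1.2): two multi-output realizations on the same inputs,
of depths `d, d'` and sizes `s, s'`, give one realization of the combined output family
`κ ⊕ κ'` of depth `max d d'` and size `s + s'` (the second program is relocated behind the
first, its input wires untouched). [cite: Vollmer1999, §1.2] -/
theorem ACVecOver.prod {B : Set GateFn} {f : (ι → Bool) → κ → Bool} {g : (ι → Bool) → κ' → Bool}
    {d d' s s' : ℕ} (hf : ACVecOver B f d s) (hg : ACVecOver B g d' s') :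
    ACVecOver B (fun x => Sum.elim (f x) (g x)) (max d d') (s + s') := by
  obtain ⟨gs, o, hwf, hb, ho, hl, hdep, hev⟩ := hf
  obtain ⟨gs', o', hwf', hb', ho', hl', hdep', hev'⟩ := hg
  refine ⟨gs ++ gs'.map (par gs.length), Sum.elim o (fun k' => shiftWire Sum.inl gs.length (o' k')),
    hwf.append_reloc hwf' (wiresOK_inl _ _root_.id), ?_, ?_, ?_, ?_, ?_⟩
  · intro g₀ hg₀
    rw [List.mem_append, List.mem_map] at hg₀
    rcases hg₀ with hg₀ | ⟨g₁, hg₁, rfl⟩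
    · exact hb g₀ hg₀
    · rw [reloc_fn]; exact hb' g₁ hg₁
  · rintro (k | k')
    · intro m hm
      simp only [Sum.elim_inl] at hm
      rw [List.length_append, List.length_map]
      exact (ho k m hm).trans_le (Nat.le_add_right _ _)
    · intro m hm
      simp only [Sum.elim_inr] at hm
      rw [List.length_append, List.length_map]
      cases hk : o' k' with
      | inl i => rw [hk] at hm; cases hm
      | inr m' =>
        rw [hk] at hm
        simp only [shiftWire, Sum.inr.injEq] at hm
        have := ho' k' m' hk
        omega
  · rw [List.length_append, List.length_map]
    exact Nat.add_le_add hl hl'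
  · rintro (k | k')
    · simp only [Sum.elim_inl]
      rw [wdepths_append_par]
      rw [wireDepthOf_append_of_lt _ _ (o k) (by rw [length_wdepths]; exact ho k)]
      exact (hdep k).trans (le_max_left _ _)
    · simp only [Sum.elim_inr]
      rw [wdepths_append_par]
      have e1 := wireDepthOf_shift_par (ι := ι) (wdepths acWeight gs) (wdepths acWeight gs') (o' k')
      rw [length_wdepths] at e1
      rw [e1]
      exact (hdep' k').trans (le_max_right _ _)
  · intro x
    rintro (k | k')
    · simp only [Sum.elim_inl]
      rw [vals_append_par, ← hev x k]
      exact wireOf_append_of_lt x _ _ (o k) (by rw [length_vals]; exact ho k)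
    · simp only [Sum.elim_inr]
      rw [vals_append_par]
      have e1 := wireOf_shift_par x (vals gs x) (vals gs' x) (o' k')
      rw [length_vals] at e1
      rw [e1]
      exact hev' x k'

/-- Juxtaposition keeping the inputs available: a layer `f` of depth `d` and size `s` together
with all input wires (depth bound `d`, no extra gate). [cite: Vollmer1999, §1.2] -/
theorem ACVecOver.keepInputs {B : Set GateFn} {f : (ι → Bool) → κ → Bool} {d s : ℕ}
    (hf : ACVecOver B f d s) : ACVecOver B (fun x => Sum.elim (f x) x) d s := by
  simpa using hf.prod (acVecOver_id B)

/-! ### Constants and literals as layers -/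

/-- A layer of constants `x ↦ (c k)ₖ` over `B ⊇ acBasis`: depth `1`, `card κ` gates. [cite: Vollmer1999, §1.2] -/
theorem acVecOver_consts {B : Set GateFn} (hB : acBasis ⊆ B) [Fintype κ] (c : κ → Bool) :
    ACVecOver B (fun (_ : ι → Bool) k => c k) 1 (Fintype.card κ * 1) :=
  acVecOver_ofBlocks_fintype_const fun k => acRealOver_const hB (c k)

/-- The layer of all input literals and their negations over `B ∋ ¬`: depth `0`,
`card ι` (free) negation gates. Output `inl i` carries `xᵢ`, output `inr i` carries `¬xᵢ`. [cite: Vollmer1999, §1.2] -/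
theorem acVecOver_literals {B : Set GateFn} (hnot : GateFn.not ∈ B) [Fintype ι] :
    ACVecOver B (fun (x : ι → Bool) (w : ι ⊕ ι) => Sum.elim x (fun i => !x i) w) 0
      (0 + Fintype.card ι * 1) := by
  have h1 : ACVecOver B (fun (x : ι → Bool) => x) 0 0 := acVecOver_id B
  have h2 : ACVecOver B (fun (x : ι → Bool) (i : ι) => !x i) 0 (Fintype.card ι * 1) :=
    acVecOver_ofBlocks_fintype_const fun i => acRealOver_notInput hnot i
  simpa using h1.prod h2

end Literature.Computability.Complexity
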